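import Mathlib
import Summits.ValiantsHypothesis.ValiantsHypothesis.Theorems.RigidityForcesSymmetryRankRigidMinimalReprLaplaceFiveSeparatedCaptureJointProlongation
import Summits.ValiantsHypothesis.ValiantsHypothesis.Theorems.RigidityForcesSymmetryRankRigidMinimalReprLaplaceFiveSeparatedCaptureTwoLines
import Summits.ValiantsHypothesis.ValiantsHypothesis.Theorems.RigidityForcesSymmetryRankRigidMinimalReprLaplaceFiveSeparatedCaptureProlongationFive

/-!
# ValiantsHypothesis / RigidityForcesSymmetry — crux `LaplaceOptimalFive` (stmt-ValiantsHypothesis-24813), symmetric capture (SC):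
# ★★ **`CaptureIneqSym` FOR TWO NON-PROPORTIONAL LINES AND A THIRD SPAN OF ANY DIMENSION** (all profiles `(1,1,r)` with `U₀₁ ≠ U₀₂`),
# and the equal-lines profiles `(1,1,r)` with `u ∉ U₁₂`, `finrank (U₁₂ ⊔ ℂu) ≤ 4`

The tree closes the profiles `(1,1,r)` for `r ≤ 2` (✓ `captureIneqSym_of_two_lines`); for two NON-proportional lines the bound
`finrank W ≤ 2` (✓ `finrank_le_two_of_nonproportional`) was limited to `finrank U₁₂ ≤ 2` only through the pair-part reduction
(✓ `finrank_le_of_vectorPart`), which needs `SF ∩ prolong U₁₂ = 0`.  Here the third span is ARBITRARY: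

* `finrank_le_two_add_of_nonproportional` — `u₁ ∦ u₂` ⇒ `finrank W ≤ finrank U₁₂ + 2`.  Proof: by ✓ `exists_good_contraction` +
  ✓ `pencil_cramer` all vector pairs `(a, b)` of the finite form `P₅ ⌞ μ = u₁(p,q)a_r + u₂(p,r)b_q + C_p(q,r)` lie in the span `AB`
  of two explicit pairs, so every obligation is congruent MODULO the one-direction space `L3 ⊥ ⊥ U₁₂` to an element of the placed
  image of `AB` (`finrank ≤ 2`); the obligations lying IN `L3 ⊥ ⊥ U₁₂` form a one-direction captured space, of `finrank ≤ finrank U₁₂`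
  by ✓ `capture_one_direction` (after the cyclic slot shift ✓ `cycle_mem_L3`); rank–nullity (✓ `finrank_le_of_split_mod`).
* ★★ `captureIneqSym_of_nonproportional_lines_any` — hence `(SC)` for `(ℂu₁, ℂu₂, U₁₂)`, `u₁ ∦ u₂`, `U₁₂` symmetric of ANY finrank.
* ★ `captureIneqSym_of_equal_lines_not_mem_le_three` — `u₂ ∈ ℂu₁`, `u₁ ∉ U₁₂`, `finrank U₁₂ ≤ 3` ⇒ `(SC)`
  (✓ `finrank_le_of_equalPencil_of_not_mem` with `P = prolong (U₁₂ ⊔ ℂu₁)`, ✓ `finrank_prolong_le_succ/five`).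
* ★★ `captureIneqSym_of_two_lines_any_of_not_mem` — assembly: two lines (equal or not) with `u₁ ∉ U₁₂` and `finrank U₁₂ ≤ 3` ⇒ `(SC)`;
  together with the first theorem this settles the profile `(1,1,3)` EXCEPT the sub-case `U₀₁ = U₀₂ = ℂu ≤ U₁₂` (located, not claimed).

Honest framing.  Sub-cases of an OPEN inequality: `CaptureIneqSym` in general (in particular `(1,1,3)` with `ℂu₁ = ℂu₂ ≤ U₁₂`, and
`(1,1,r)`, `r ≥ 4`, with equal lines), K1 on `K₃ ⊔ K₂`, S2′, `LaplaceOptimalFive` (stmt-24813, OPEN · CONTESTED 72/120),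
`RankRigidMinimalRepr`, `VP ≠ VNP` are NOT proved.  No definitions, no `sorry`; Mathlib + tree only.
-/

set_option linter.dupNamespace false
set_option autoImplicit false

namespace Summit.ValiantsHypothesis.ValiantsHypothesis.Theorems.RigidityForcesSymmetryRankRigidMinimalRepr

namespace LaplaceFiveSeparatedCapture

open Finset

/-- A symmetric obligation captured by the `12`-direction alone is captured by the `01`-direction alone (cyclic slot shift). [folklore] -/
theorem mem_L3_01_of_mem_L3_12 (U12 : Submodule ℂ (Fin 5 → Fin 5 → ℂ)) (μ : Fin 5 → Fin 5 → ℂ)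
    (h : contractZ μ ∈ L3 ⊥ ⊥ U12) : contractZ μ ∈ L3 U12 ⊥ ⊥ := by
  have hc := cycle_mem_L3 U12 (contractZ μ) h
  have e : (fun p q r => contractZ μ r p q) = contractZ μ := by
    funext p q r
    rw [contractZ_swap12 μ p r q, contractZ_swap23 μ p q r]
  rw [e] at hc
  exact hc

/-- ★ **TWO NON-PROPORTIONAL LINES, THIRD SPAN ARBITRARY: `finrank W ≤ finrank U₁₂ + 2`.** [folklore] -/
theorem finrank_le_two_add_of_nonproportional (u₁ u₂ : Fin 5 → Fin 5 → ℂ)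
    (hu₁ : ∀ p q, u₁ p q = u₁ q p) (hu₂ : ∀ p q, u₂ p q = u₂ q p)
    (hnp : ∃ i j k l, u₁ i j * u₂ k l ≠ u₁ k l * u₂ i j)
    (U12 W : Submodule ℂ (Fin 5 → Fin 5 → ℂ)) (hU12 : ∀ x ∈ U12, ∀ p q : Fin 5, x p q = x q p)
    (hWs : ∀ μ ∈ W, ∀ s t : Fin 5, μ s t = μ t s) (hWd : ∀ μ ∈ W, ∀ s : Fin 5, μ s s = 0)
    (hWc : ∀ μ ∈ W, contractZ μ ∈ L3 (ℂ ∙ u₁) (ℂ ∙ u₂) U12) :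
    Module.finrank ℂ W ≤ Module.finrank ℂ U12 + 2 := by
  classical
  obtain ⟨w, p₁, p₂, hm⟩ := exists_good_contraction u₁ u₂ hu₁ hu₂ hnp
  set X₁ := ∑ q, u₁ p₁ q * w q with hX₁
  set X₂ := ∑ q, u₁ p₂ q * w q with hX₂
  set Y₁ := ∑ q, u₂ p₁ q * w q with hY₁
  set Y₂ := ∑ q, u₂ p₂ q * w q with hY₂
  set m := X₁ * Y₂ - X₂ * Y₁ with hm_def
  -- the two spanning pairs and their placed images
  let F : (Fin 5 → ℂ) × (Fin 5 → ℂ) :=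
    (fun r => Y₂ * u₁ p₁ r - Y₁ * u₁ p₂ r, fun r => X₂ * u₁ p₁ r - X₁ * u₁ p₂ r)
  let G : (Fin 5 → ℂ) × (Fin 5 → ℂ) :=
    (fun r => Y₁ * u₂ p₂ r - Y₂ * u₂ p₁ r, fun r => X₁ * u₂ p₂ r - X₂ * u₂ p₁ r)
  let AB : Submodule ℂ ((Fin 5 → ℂ) × (Fin 5 → ℂ)) := Submodule.span ℂ {F, G}
  have hAB2 : Module.finrank ℂ AB ≤ 2 := by
    have := finrank_span_le_card (R := ℂ) ({F, G} : Set ((Fin 5 → ℂ) × (Fin 5 → ℂ)))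
    refine this.trans ?_
    simp only [Set.toFinset_insert, Set.toFinset_singleton]
    exact Finset.card_insert_le _ _
  let L : ((Fin 5 → ℂ) × (Fin 5 → ℂ)) →ₗ[ℂ] (Fin 5 → Fin 5 → Fin 5 → ℂ) :=
    { toFun := fun ab => fun p q r => u₁ p q * ab.1 r + u₂ p r * ab.2 q
      map_add' := fun x y => by
        funext p q r
        simp only [Prod.fst_add, Prod.snd_add, Pi.add_apply]
        ring
      map_smul' := fun s x => by
        funext p q r
        simp only [Prod.smul_fst, Prod.smul_snd, Pi.smul_apply, smul_eq_mul, RingHom.id_apply]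
        ring }
  have hL : ∀ ab : (Fin 5 → ℂ) × (Fin 5 → ℂ), L ab = fun p q r => u₁ p q * ab.1 r + u₂ p r * ab.2 q := fun ab => rfl
  have hM : Module.finrank ℂ (AB.map L) ≤ 2 := (Submodule.finrank_map_le L AB).trans hAB2
  -- split modulo the one-direction space `L3 ⊥ ⊥ U12`
  have hsplit : ∀ μ ∈ W, ∃ G' ∈ AB.map L, contractZ μ - G' ∈ L3 ⊥ ⊥ U12 := by
    intro μ hμ
    obtain ⟨a, b, C, hC, hT⟩ := vectors_form_of_mem_L3 u₁ u₂ U12 (hWc μ hμ)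
    have hS : ∀ p q r, u₁ p q * a r - u₂ p q * b r = u₁ p r * a q - u₂ p r * b q := by
      intro p q r
      have h := contractZ_swap23 μ p q r
      rw [hT, hT, hU12 _ (hC p) r q] at h
      linear_combination -h
    obtain ⟨ha, hb⟩ := pencil_cramer u₁ u₂ a b w hS p₁ p₂ X₁ X₂ Y₁ Y₂ (∑ q, a q * w q) (∑ q, b q * w q)
      hX₁ hX₂ hY₁ hY₂ rfl rfl
    have hab : (a, b) ∈ AB := by
      rw [Submodule.mem_span_pair]
      refine ⟨m⁻¹ * ∑ q, a q * w q, m⁻¹ * ∑ q, b q * w q, ?_⟩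
      ext r
      · have key := ha r
        rw [← hm_def] at key
        have har : a r = m⁻¹ * ((∑ q, a q * w q) * (Y₂ * u₁ p₁ r - Y₁ * u₁ p₂ r)
            + (∑ q, b q * w q) * (Y₁ * u₂ p₂ r - Y₂ * u₂ p₁ r)) := (eq_inv_mul_iff_mul_eq₀ hm).mpr key
        simp only [Prod.fst_add, Prod.smul_fst, Pi.add_apply, Pi.smul_apply, smul_eq_mul, F, G]
        rw [har]; ring
      · have key := hb r
        rw [← hm_def] at key
        have hbr : b r = m⁻¹ * ((∑ q, a q * w q) * (X₂ * u₁ p₁ r - X₁ * u₁ p₂ r)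
            + (∑ q, b q * w q) * (X₁ * u₂ p₂ r - X₂ * u₂ p₁ r)) := (eq_inv_mul_iff_mul_eq₀ hm).mpr key
        simp only [Prod.snd_add, Prod.smul_snd, Pi.add_apply, Pi.smul_apply, smul_eq_mul, F, G]
        rw [hbr]; ring
    refine ⟨L (a, b), Submodule.mem_map.mpr ⟨(a, b), hab, rfl⟩, ?_⟩
    have e : contractZ μ - L (a, b) = fun p q r => C p q r := by
      funext p q r
      simp only [Pi.sub_apply, hL, hT p q r]
      ring
    rw [e]
    exact placed12_mem_L3 ⊥ ⊥ U12 C hC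
  -- the obligations inside the one-direction space
  have hker : ∀ W' : Submodule ℂ (Fin 5 → Fin 5 → ℂ), W' ≤ W → (∀ μ ∈ W', contractZ μ ∈ L3 ⊥ ⊥ U12) →
      Module.finrank ℂ W' ≤ Module.finrank ℂ U12 := by
    intro W' hW' hW'c
    have h := capture_one_direction U12 ⊥ ⊥ W' rfl rfl (fun μ hμ => hWs μ (hW' hμ)) (fun μ hμ => hWd μ (hW' hμ))
      (fun μ hμ => mem_L3_01_of_mem_L3_12 U12 μ (hW'c μ hμ))
    simpa using h
  have h := finrank_le_of_split_mod W (L3 ⊥ ⊥ U12) (AB.map L) (Module.finrank ℂ U12) hsplit hker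
  omega

/-- ★★ **`CaptureIneqSym` FOR TWO NON-PROPORTIONAL LINES AND A THIRD SPAN OF ANY DIMENSION** (all profiles `(1,1,r)` with
`U₀₁ ≠ U₀₂`): `finrank W ≤ finrank (ℂ∙u₁) + finrank (ℂ∙u₂) + finrank U₁₂`. [folklore] -/
theorem captureIneqSym_of_nonproportional_lines_any (u₁ u₂ : Fin 5 → Fin 5 → ℂ)
    (hu₁ : ∀ p q, u₁ p q = u₁ q p) (hu₂ : ∀ p q, u₂ p q = u₂ q p)
    (hnp : ∃ i j k l, u₁ i j * u₂ k l ≠ u₁ k l * u₂ i j)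
    (U12 W : Submodule ℂ (Fin 5 → Fin 5 → ℂ)) (hU12 : ∀ x ∈ U12, ∀ p q : Fin 5, x p q = x q p)
    (hWs : ∀ μ ∈ W, ∀ s t : Fin 5, μ s t = μ t s) (hWd : ∀ μ ∈ W, ∀ s : Fin 5, μ s s = 0)
    (hWc : ∀ μ ∈ W, contractZ μ ∈ L3 (ℂ ∙ u₁) (ℂ ∙ u₂) U12) :
    Module.finrank ℂ W ≤ Module.finrank ℂ (ℂ ∙ u₁) + Module.finrank ℂ (ℂ ∙ u₂) + Module.finrank ℂ U12 := by
  have h := finrank_le_two_add_of_nonproportional u₁ u₂ hu₁ hu₂ hnp U12 W hU12 hWs hWd hWc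
  obtain ⟨i, j, k, l, hne⟩ := hnp
  have h1 : u₁ ≠ 0 := by
    intro h0; apply hne; rw [h0]; simp
  have h2 : u₂ ≠ 0 := by
    intro h0; apply hne; rw [h0]; simp
  rw [finrank_span_singleton h1, finrank_span_singleton h2]
  omega

/-- ★ **EQUAL LINES `U₀₁ = U₀₂ = ℂu₁` WITH `u₁ ∉ U₁₂` AND `finrank U₁₂ ≤ 3`**: `(SC)` holds, by
✓ `finrank_le_of_equalPencil_of_not_mem` with `P = prolong (U₁₂ ⊔ ℂu₁)` and ✓ `finrank_prolong_le_succ` / ✓ `finrank_prolong_le_five`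
(`finrank (U₁₂ ⊔ ℂu₁) = finrank U₁₂ + 1 ≤ 4`). [folklore] -/
theorem captureIneqSym_of_equal_lines_not_mem_le_three (u₁ u₂ : Fin 5 → Fin 5 → ℂ)
    (hu₁ : ∀ p q, u₁ p q = u₁ q p) (h₁ : u₁ ≠ 0) (h₂ : u₂ ≠ 0) (hprop : u₂ ∈ ℂ ∙ u₁)
    (U12 W : Submodule ℂ (Fin 5 → Fin 5 → ℂ)) (hU12 : ∀ x ∈ U12, ∀ p q : Fin 5, x p q = x q p)
    (huV : u₁ ∉ U12) (hd : Module.finrank ℂ U12 ≤ 3)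
    (hWs : ∀ μ ∈ W, ∀ s t : Fin 5, μ s t = μ t s) (hWd : ∀ μ ∈ W, ∀ s : Fin 5, μ s s = 0)
    (hWc : ∀ μ ∈ W, contractZ μ ∈ L3 (ℂ ∙ u₁) (ℂ ∙ u₂) U12) :
    Module.finrank ℂ W ≤ Module.finrank ℂ (ℂ ∙ u₁) + Module.finrank ℂ (ℂ ∙ u₂) + Module.finrank ℂ U12 := by
  obtain ⟨t, ht⟩ := Submodule.mem_span_singleton.mp hprop
  have htne : t ≠ 0 := by
    rintro rfl; apply h₂; rw [← ht, zero_smul]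
  have hspan : (ℂ ∙ u₂) = (ℂ ∙ u₁) := by
    rw [← ht]; exact Submodule.span_singleton_smul_eq (isUnit_iff_ne_zero.mpr htne) u₁
  have hWc' : ∀ μ ∈ W, contractZ μ ∈ L3 (ℂ ∙ u₁) (ℂ ∙ u₁) U12 := fun μ hμ => by
    have := hWc μ hμ; rwa [hspan] at this
  let X : Submodule ℂ (Fin 5 → Fin 5 → ℂ) := U12 ⊔ (ℂ ∙ u₁)
  have hXs : ∀ x ∈ X, ∀ q r : Fin 5, x q r = x r q := by
    intro x hx q r
    obtain ⟨y, hy, z, hz, rfl⟩ := Submodule.mem_sup.mp hx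
    obtain ⟨c, rfl⟩ := Submodule.mem_span_singleton.mp hz
    simp only [Pi.add_apply, Pi.smul_apply, smul_eq_mul, hU12 y hy q r, hu₁ q r]
  have hP : ∀ G : Fin 5 → Fin 5 → Fin 5 → ℂ, (∀ p q r, G p q r = G q p r) → (∀ p q r, G p q r = G p r q) →
      (∀ p, G p ∈ U12 ⊔ (ℂ ∙ u₁)) → G ∈ prolong X := fun G hG1 hG2 hG3 =>
    (mem_prolong_iff X G).mpr ⟨hG1, hG2, hG3⟩
  have h := finrank_le_of_equalPencil_of_not_mem u₁ hu₁ U12 W hU12 huV hWs hWd hWc' (prolong X) hP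
  have hX : Module.finrank ℂ X = Module.finrank ℂ U12 + 1 := by
    have hdisj : Disjoint U12 (ℂ ∙ u₁) := by
      rw [Submodule.disjoint_span_singleton']
      · exact huV
      · exact h₁
    have := Submodule.finrank_sup_add_finrank_inf_eq U12 (ℂ ∙ u₁)
    rw [hdisj.eq_bot, finrank_bot, add_zero, finrank_span_singleton h₁] at this
    exact this
  rw [finrank_span_singleton h₁, finrank_span_singleton h₂]
  by_cases h3 : Module.finrank ℂ X ≤ 3
  · have hp := finrank_prolong_le_succ X hXs h3
    omega
  · have hp := finrank_prolong_le_five X hXs (by omega)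
    omega

/-- ★★ **ASSEMBLY: TWO LINES (EQUAL OR NOT) WITH `u₁ ∉ U₁₂` AND `finrank U₁₂ ≤ 3` ⇒ `(SC)`.**  With ✓ `captureIneqSym_of_two_lines`
(`finrank U₁₂ ≤ 2`) this settles the profile `(1,1,3)` except the sub-case `ℂu₁ = ℂu₂ ≤ U₁₂` (located, OPEN here). [folklore] -/
theorem captureIneqSym_of_two_lines_any_of_not_mem (u₁ u₂ : Fin 5 → Fin 5 → ℂ)
    (hu₁ : ∀ p q, u₁ p q = u₁ q p) (hu₂ : ∀ p q, u₂ p q = u₂ q p) (h₁ : u₁ ≠ 0) (h₂ : u₂ ≠ 0)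
    (U12 W : Submodule ℂ (Fin 5 → Fin 5 → ℂ)) (hU12 : ∀ x ∈ U12, ∀ p q : Fin 5, x p q = x q p)
    (huV : u₁ ∉ U12) (hd : Module.finrank ℂ U12 ≤ 3)
    (hWs : ∀ μ ∈ W, ∀ s t : Fin 5, μ s t = μ t s) (hWd : ∀ μ ∈ W, ∀ s : Fin 5, μ s s = 0)
    (hWc : ∀ μ ∈ W, contractZ μ ∈ L3 (ℂ ∙ u₁) (ℂ ∙ u₂) U12) :
    Module.finrank ℂ W ≤ Module.finrank ℂ (ℂ ∙ u₁) + Module.finrank ℂ (ℂ ∙ u₂) + Module.finrank ℂ U12 := by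
  classical
  by_cases hnp : ∃ i j k l, u₁ i j * u₂ k l ≠ u₁ k l * u₂ i j
  · exact captureIneqSym_of_nonproportional_lines_any u₁ u₂ hu₁ hu₂ hnp U12 W hU12 hWs hWd hWc
  push Not at hnp
  -- `u₂ = t • u₁`
  have hne : ∃ i j, u₁ i j ≠ 0 := by
    by_contra h
    push Not at h
    exact h₁ (funext fun p => funext fun q => h p q)
  obtain ⟨i₀, j₀, h0⟩ := hne
  have hu₂t : u₂ = (u₂ i₀ j₀ / u₁ i₀ j₀) • u₁ := by
    funext k l
    simp only [Pi.smul_apply, smul_eq_mul]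
    have := hnp i₀ j₀ k l
    field_simp
    linear_combination this
  have hprop : u₂ ∈ ℂ ∙ u₁ := Submodule.mem_span_singleton.mpr ⟨_, hu₂t.symm⟩
  exact captureIneqSym_of_equal_lines_not_mem_le_three u₁ u₂ hu₁ h₁ h₂ hprop U12 W hU12 huV hd hWs hWd hWc

end LaplaceFiveSeparatedCapture

end Summit.ValiantsHypothesis.ValiantsHypothesis.Theorems.RigidityForcesSymmetryRankRigidMinimalRepr
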